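import Literature.MathematicalPhysics.QuantumManyBody.PeriodicHardCoreFormData
import Literature.Analysis.FunctionSpaces.TorusHardCoreCutoffEnergy
import HarnessLib

/-!
# Energy of the smoothly cut-off trigonometric polynomial near the hard cores

`Literature/MathematicalPhysics/QuantumManyBody` support file (everything proved; no definitions, no
named facts), namespace `Literature.MathematicalPhysics.QuantumManyBody.BoseGas`; states in
`L²((ℝ/ℤ)^{N×3}, μ_H)`. The three estimates on the trial function `F = χ̃ · P` of the hard-core
maximal-form bound, where `χ̃ = Torus.pairCutoff Torus.smoothCutProfile r δ'` is the smooth cut-off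
(`= 0` where some `ρᵢⱼ ≤ r + δ'`, `= 1` where all `ρᵢⱼ ≥ r + 2δ'`), `P` is (the class of) any `L²`
function and `ζ` is the cut-off state `χ_δ η` of `PeriodicHardCoreCutoffState` with `δ = 4δ'`
(so that `ζ = 0` on the collars of `χ̃` and `χ̃ = 1` on the support of `ζ`):

* `maxFormPot_le_of_coeFn_eq_pairCutoff_mul` — **potential**: if `v` and `v'` agree on `(a, ∞)` and
  `r = a/L`, then `maxFormPot v L F ≤ maxFormPot v' L P` (on the support of `χ̃` every image of every
  pair is farther than `a`, where `v = v'`; and `|χ̃| ≤ 1`);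
* `maxFormKin_le_of_coeFn_eq_pairCutoff_mul` — **kinetic**:
  `maxFormKin L F ≤ (1+ε) maxFormKin L P + C(ε, δ', N, K, L) · ‖P - ζ‖²` (the Leibniz estimate
  `Torus.tsum_sq_pairCutoff_mul_le` direction by direction; on the collars of `χ̃`, `P = P - ζ` and
  `(ρ - r)⁻² ≤ 16/δ'²`);
* `norm_sub_le_of_coeFn_eq_pairCutoff_mul` — **mass**: `‖F - ζ‖ ≤ ‖P - ζ‖` (`F - ζ = χ̃ (P - ζ)`).

## Mathlib / tree search

Tree: `Torus.tsum_sq_pairCutoff_mul_le`, `Torus.pairCutoff_eq_zero(_of_ne)`, `Torus.pairCutoff_eq_one`,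
`periodicInteraction_mul_eq_of_vanish`, `maxFormKin_eq_tsum_dir`, `maxFormPot_eq_lintegral`,
`norm_Lp_two_sq_eq_toReal`.
-/

noncomputable section

open MeasureTheory Filter Set Complex UnitAddTorus
open scoped ENNReal NNReal Topology InnerProductSpace
open Literature.Analysis.FunctionSpaces

namespace Literature.MathematicalPhysics.QuantumManyBody.BoseGas

variable {N : ℕ} {L : ℝ} {v : ℝ → ℝ≥0∞}

/-- Local notation for `L²((ℝ/ℤ)^{3N}, μ_H)` (the `L2T N` of `PeriodicFormDomain.lean`). -/
local notation "L2H " N':max =>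
  Lp ℂ 2 (Measure.pi fun _ : Fin N' × Fin 3 => (AddCircle.haarAddCircle : Measure UnitAddCircle))

/-! ## `L²` bookkeeping -/

/-- An a.e. equality for the Haar product measure is one for the global `volume`. [folklore] -/
theorem ae_global_of_ae_haar {p : UnitAddTorus (Fin N × Fin 3) → Prop}
    (h : ∀ᵐ t ∂(Measure.pi fun _ : Fin N × Fin 3 => (AddCircle.haarAddCircle : Measure UnitAddCircle)), p t) :
    ∀ᵐ t : UnitAddTorus (Fin N × Fin 3), p t := by
  rwa [Torus.volume_eq_pi_haarAddCircle]

/-- `∫⁻ ‖x‖ₑ² = ofReal ‖x‖²` for an `L2H` class (global `volume`). [folklore] -/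
theorem lintegral_enorm_sq_eq_ofReal (x : L2H N) :
    ∫⁻ t, ‖(x : UnitAddTorus (Fin N × Fin 3) → ℂ) t‖ₑ ^ 2 = ENNReal.ofReal (‖x‖ ^ 2) := by
  obtain ⟨h1, h2⟩ := norm_Lp_two_sq_eq_toReal x
  rw [h1, ENNReal.ofReal_toReal h2, Torus.volume_eq_pi_haarAddCircle]
  simp only [enorm_eq_nnnorm]

/-- `∫⁻ ‖x - y‖ₑ² = ofReal ‖x - y‖²` pointwise a.e. form. [folklore] -/
theorem lintegral_enorm_sub_sq_eq_ofReal (x y : L2H N) :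
    ∫⁻ t, ‖(x : UnitAddTorus (Fin N × Fin 3) → ℂ) t - (y : UnitAddTorus (Fin N × Fin 3) → ℂ) t‖ₑ ^ 2 =
      ENNReal.ofReal (‖x - y‖ ^ 2) := by
  rw [← lintegral_enorm_sq_eq_ofReal]
  refine lintegral_congr_ae ?_
  filter_upwards [ae_global_of_ae_haar (Lp.coeFn_sub x y)] with t ht
  rw [ht, Pi.sub_apply]

/-! ## The potential energy of `χ̃ P` -/

/-- Pointwise monotonicity of the periodic interaction in the profile. [folklore] -/
theorem periodicInteraction_mono_profile' {v w : ℝ → ℝ≥0∞} (h : ∀ ρ, w ρ ≤ v ρ) (L : ℝ) (X : Config N) :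
    periodicInteraction w L X ≤ periodicInteraction v L X := by
  unfold periodicInteraction periodizedPotential
  exact Finset.sum_le_sum fun i _ => Finset.sum_le_sum fun j _ => ENNReal.tsum_le_tsum fun n => h _

/-- Monotonicity of the potential term in the profile. [folklore] -/
theorem maxFormPot_mono_profile {v w : ℝ → ℝ≥0∞} (h : ∀ ρ, w ρ ≤ v ρ) (L : ℝ) (η : L2H N) :
    maxFormPot w L η ≤ maxFormPot v L η := by
  rw [maxFormPot_eq_lintegral, maxFormPot_eq_lintegral]
  exact lintegral_mono fun t => mul_le_mul_left (periodicInteraction_mono_profile' h L _) _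

/-- **Potential energy of the smoothly cut-off function.** Let `v = v'` on `(a, ∞)`, `0 < L`,
`0 < δ'`, `θ` a cut profile, and `F = χ̃ P` a.e. with `χ̃ = pairCutoff θ (a/L) δ'`. Then
`maxFormPot v L F ≤ maxFormPot v' L P`: where `χ̃ ≠ 0` all pairs have `L ρᵢⱼ > a`, so the hard
core is invisible, and `|χ̃| ≤ 1`. [folklore] -/
theorem maxFormPot_le_of_coeFn_eq_pairCutoff_mul (hL : 0 < L) {v' : ℝ → ℝ≥0∞} {a : ℝ}
    (hvv' : ∀ ρ : ℝ, a < ρ → v ρ = v' ρ) {K : NNReal} {θ : ℝ → ℝ} (hθ : Torus.IsCutProfile K θ)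
    {δ' : ℝ} (hδ' : 0 < δ') {P F : L2H N}
    (hF : (F : UnitAddTorus (Fin N × Fin 3) → ℂ) =ᵐ[volume]
      fun t => (Torus.pairCutoff θ (a / L) δ' t : ℂ) * (P : UnitAddTorus (Fin N × Fin 3) → ℂ) t) :
    maxFormPot v L F ≤ maxFormPot v' L P := by
  rw [maxFormPot_eq_lintegral, maxFormPot_eq_lintegral]
  calc ∫⁻ t, periodicInteraction v L (fromUnitTorusN L t) * ‖(F : UnitAddTorus (Fin N × Fin 3) → ℂ) t‖ₑ ^ 2
      = ∫⁻ t, periodicInteraction v L (fromUnitTorusN L t) *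
          ‖(Torus.pairCutoff θ (a / L) δ' t : ℂ) * (P : UnitAddTorus (Fin N × Fin 3) → ℂ) t‖ₑ ^ 2 :=
        lintegral_congr_ae (by filter_upwards [hF] with t ht; rw [ht])
    _ = ∫⁻ t, periodicInteraction v' L (fromUnitTorusN L t) *
          ‖(Torus.pairCutoff θ (a / L) δ' t : ℂ) * (P : UnitAddTorus (Fin N × Fin 3) → ℂ) t‖ₑ ^ 2 := by
        refine lintegral_congr fun t => periodicInteraction_mul_eq_of_vanish hvv' hL.le
          (F := fun t => ‖(Torus.pairCutoff θ (a / L) δ' t : ℂ) * (P : UnitAddTorus (Fin N × Fin 3) → ℂ) t‖ₑ ^ 2)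
          (fun t => ?_) t
        by_cases h : ∃ i j : Fin N, i < j ∧ Torus.pairDist i j t ≤ a / L + δ'
        · obtain ⟨i, j, hij, hle⟩ := h
          left
          rw [Torus.pairCutoff_eq_zero hθ hδ' hij hle, Complex.ofReal_zero, zero_mul, enorm_zero, zero_pow two_ne_zero]
        · right
          intro i j hij
          push Not at h
          have h' := h i j hij
          have : a / L < Torus.pairDist i j t := by linarith
          rwa [div_lt_iff₀ hL, mul_comm] at this
    _ ≤ ∫⁻ t, periodicInteraction v' L (fromUnitTorusN L t) * ‖(P : UnitAddTorus (Fin N × Fin 3) → ℂ) t‖ₑ ^ 2 := by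
        refine lintegral_mono fun t => mul_le_mul_right ?_ _
        rw [enorm_mul]
        refine (pow_le_pow_left' (mul_le_of_le_one_left zero_le ?_) 2)
        rw [← ofReal_norm, Complex.norm_real, Real.norm_eq_abs]
        exact ENNReal.ofReal_le_one.2 (Torus.abs_pairCutoff_le_one hθ _ _ t)

/-! ## The mass of `χ̃ P` -/

/-- **`χ̃ = 1` on the support of the cut-off state**: with `χ_δ = pairCutoff θ r δ` and
`χ̃ = pairCutoff θ' r δ'`, `2δ' ≤ δ`: wherever `χ_δ(t) ≠ 0` one has `χ̃(t) = 1`. [folklore] -/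
theorem pairCutoff_eq_one_of_pairCutoff_ne_zero {K K' : NNReal} {θ θ' : ℝ → ℝ} (hθ : Torus.IsCutProfile K θ)
    (hθ' : Torus.IsCutProfile K' θ') {r δ δ' : ℝ} (hδ : 0 < δ) (hδ' : 0 < δ') (h2 : 2 * δ' ≤ δ)
    {t : UnitAddTorus (Fin N × Fin 3)} (ht : Torus.pairCutoff θ r δ t ≠ 0) :
    Torus.pairCutoff θ' r δ' t = 1 := by
  refine Torus.pairCutoff_eq_one hθ' hδ' fun i j hij => ?_
  by_contra hlt
  exact ht (Torus.pairCutoff_eq_zero hθ hδ hij (by linarith [not_le.1 hlt]))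

/-- **Mass of the smoothly cut-off function**: if `F = χ̃ P` and `ζ = χ_δ η` a.e. with `2δ' ≤ δ`,
then `‖F - ζ‖ ≤ ‖P - ζ‖` (`F - ζ = χ̃ (P - ζ)` a.e. and `|χ̃| ≤ 1`). [folklore] -/
theorem norm_sub_le_of_coeFn_eq_pairCutoff_mul {K K' : NNReal} {θ θ' : ℝ → ℝ} (hθ : Torus.IsCutProfile K θ)
    (hθ' : Torus.IsCutProfile K' θ') {r δ δ' : ℝ} (hδ : 0 < δ) (hδ' : 0 < δ') (h2 : 2 * δ' ≤ δ)
    {η P F ζ : L2H N}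
    (hF : (F : UnitAddTorus (Fin N × Fin 3) → ℂ) =ᵐ[volume]
      fun t => (Torus.pairCutoff θ' r δ' t : ℂ) * (P : UnitAddTorus (Fin N × Fin 3) → ℂ) t)
    (hζ : (ζ : UnitAddTorus (Fin N × Fin 3) → ℂ) =ᵐ[volume]
      fun t => (Torus.pairCutoff θ r δ t : ℂ) * (η : UnitAddTorus (Fin N × Fin 3) → ℂ) t) :
    ‖F - ζ‖ ≤ ‖P - ζ‖ := by
  have hsq : ‖F - ζ‖ ^ 2 ≤ ‖P - ζ‖ ^ 2 := by
    rw [← ENNReal.ofReal_le_ofReal_iff (sq_nonneg _), ← lintegral_enorm_sub_sq_eq_ofReal,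
      ← lintegral_enorm_sub_sq_eq_ofReal]
    refine lintegral_mono_ae ?_
    filter_upwards [hF, hζ] with t hFt hζt
    -- `F t - ζ t = χ̃ t (P t - ζ t)`
    have hid : (F : UnitAddTorus (Fin N × Fin 3) → ℂ) t - (ζ : UnitAddTorus (Fin N × Fin 3) → ℂ) t =
        (Torus.pairCutoff θ' r δ' t : ℂ) *
          ((P : UnitAddTorus (Fin N × Fin 3) → ℂ) t - (ζ : UnitAddTorus (Fin N × Fin 3) → ℂ) t) := by
      rw [hFt, hζt]
      by_cases h0 : Torus.pairCutoff θ r δ t = 0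
      · rw [h0, Complex.ofReal_zero, zero_mul, sub_zero, sub_zero]
      · rw [pairCutoff_eq_one_of_pairCutoff_ne_zero hθ hθ' hδ hδ' h2 h0, Complex.ofReal_one, one_mul, one_mul]
    rw [hid, enorm_mul]
    refine pow_le_pow_left' (mul_le_of_le_one_left zero_le ?_) 2
    rw [← ofReal_norm, Complex.norm_real, Real.norm_eq_abs]
    exact ENNReal.ofReal_le_one.2 (Torus.abs_pairCutoff_le_one hθ' _ _ t)
  exact (pow_le_pow_iff_left₀ (norm_nonneg _) (norm_nonneg _) two_ne_zero).1 hsq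

/-! ## The kinetic energy of `χ̃ P` -/

/-- **The collars of `χ̃` lie in the zero set of the cut-off state**: with `χ_δ = pairCutoff θ r δ`
and `5δ'/2 ≤ δ`, on `C_{ij}(δ') = {r + δ'/2 < ρᵢⱼ < r + 5δ'/2}` (`i ≠ j`) one has `χ_δ = 0`.
[folklore] -/
theorem pairCutoff_eq_zero_on_collar {K : NNReal} {θ : ℝ → ℝ} (hθ : Torus.IsCutProfile K θ) {r δ δ' : ℝ}
    (hδ : 0 < δ) (h2 : 5 * δ' / 2 ≤ δ) {i j : Fin N} (hij : i ≠ j) {t : UnitAddTorus (Fin N × Fin 3)}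
    (ht : t ∈ {t | r + δ' / 2 < Torus.pairDist i j t ∧ Torus.pairDist i j t < r + 5 * δ' / 2}) :
    Torus.pairCutoff θ r δ t = 0 :=
  Torus.pairCutoff_eq_zero_of_ne hθ hδ hij (by have := ht.2; linarith)

/-- **The collar integrals of `P` are controlled by `‖P - ζ‖`**: for `i ≠ j`, `0 < δ'`, `5δ'/2 ≤ δ`,
`ζ = χ_δ η` a.e.,
`∫⁻_{C_{ij}(δ')} ‖P‖ₑ²/(ρᵢⱼ - r)² ≤ (4/δ'²) ‖P - ζ‖²`. [folklore] -/
theorem collar_lintegral_le_norm_sub_sq {K : NNReal} {θ : ℝ → ℝ} (hθ : Torus.IsCutProfile K θ) {r δ δ' : ℝ}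
    (hδ : 0 < δ) (hδ' : 0 < δ') (h2 : 5 * δ' / 2 ≤ δ) {i j : Fin N} (hij : i ≠ j) {η P ζ : L2H N}
    (hζ : (ζ : UnitAddTorus (Fin N × Fin 3) → ℂ) =ᵐ[volume]
      fun t => (Torus.pairCutoff θ r δ t : ℂ) * (η : UnitAddTorus (Fin N × Fin 3) → ℂ) t) :
    ∫⁻ t in {t | r + δ' / 2 < Torus.pairDist i j t ∧ Torus.pairDist i j t < r + 5 * δ' / 2},
        ‖(P : UnitAddTorus (Fin N × Fin 3) → ℂ) t‖ₑ ^ 2 / ENNReal.ofReal ((Torus.pairDist i j t - r) ^ 2) ≤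
      ENNReal.ofReal (4 / δ' ^ 2) * ENNReal.ofReal (‖P - ζ‖ ^ 2) := by
  set C : Set (UnitAddTorus (Fin N × Fin 3)) :=
    {t | r + δ' / 2 < Torus.pairDist i j t ∧ Torus.pairDist i j t < r + 5 * δ' / 2} with hC
  have hCm : MeasurableSet C :=
    (measurableSet_lt measurable_const (Torus.continuous_pairDist i j).measurable).inter
      (measurableSet_lt (Torus.continuous_pairDist i j).measurable measurable_const)
  rw [← lintegral_enorm_sub_sq_eq_ofReal, ← lintegral_const_mul' _ _ ENNReal.ofReal_ne_top]
  calc ∫⁻ t in C, ‖(P : UnitAddTorus (Fin N × Fin 3) → ℂ) t‖ₑ ^ 2 / ENNReal.ofReal ((Torus.pairDist i j t - r) ^ 2)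
      ≤ ∫⁻ t in C, ENNReal.ofReal (4 / δ' ^ 2) *
          ‖(P : UnitAddTorus (Fin N × Fin 3) → ℂ) t - (ζ : UnitAddTorus (Fin N × Fin 3) → ℂ) t‖ₑ ^ 2 := by
        refine setLIntegral_mono_ae ?_ (hζ.mono fun t ht htC => ?_)
        · exact (measurable_const.mul (((Lp.stronglyMeasurable P).measurable.sub
            (Lp.stronglyMeasurable ζ).measurable).enorm.pow_const 2)).aemeasurable
        -- on `C`: `ζ t = 0` and `(ρ - r)² > δ'²/4`
        have hζ0 : (ζ : UnitAddTorus (Fin N × Fin 3) → ℂ) t = 0 := by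
          rw [ht]
          show (Torus.pairCutoff θ r δ t : ℂ) * (η : UnitAddTorus (Fin N × Fin 3) → ℂ) t = 0
          rw [pairCutoff_eq_zero_on_collar hθ hδ h2 hij htC, Complex.ofReal_zero, zero_mul]
        rw [hζ0, sub_zero, ENNReal.div_eq_inv_mul]
        refine mul_le_mul_left ?_ _
        have hρ : δ' / 2 < Torus.pairDist i j t - r := by have := htC.1; linarith
        have hρ2 : 0 < (Torus.pairDist i j t - r) ^ 2 := pow_pos (by linarith) 2
        rw [← ENNReal.ofReal_inv_of_pos hρ2]
        refine ENNReal.ofReal_le_ofReal ?_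
        rw [inv_eq_one_div, div_le_div_iff₀ hρ2 (by positivity), one_mul]
        nlinarith
    _ ≤ ∫⁻ t, ENNReal.ofReal (4 / δ' ^ 2) *
          ‖(P : UnitAddTorus (Fin N × Fin 3) → ℂ) t - (ζ : UnitAddTorus (Fin N × Fin 3) → ℂ) t‖ₑ ^ 2 :=
        setLIntegral_le_lintegral _ _

/-- **Kinetic energy of the smoothly cut-off function.** Let `θ'` be a cut profile with constant `K`,
`0 < r`, `0 < δ'`, `F = χ̃ P` a.e. (`χ̃ = pairCutoff θ' r δ'`), and suppose the collar integrals of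
`P` are bounded, `∫⁻_{C_{ij}(δ')} ‖P‖ₑ²/(ρᵢⱼ - r)² ≤ B` for `i ≠ j` (the diagonal collars are empty).
Then for `ε > 0`,
`maxFormKin L F ≤ (1+ε) maxFormKin L P + (2π/L)² |Fin N × Fin 3| (1+ε⁻¹)(2π)⁻² N · 25K² · N · B`.
[folklore] -/
theorem maxFormKin_le_of_coeFn_eq_pairCutoff_mul {K : NNReal} {θ' : ℝ → ℝ} (hθ' : Torus.IsCutProfile K θ')
    {r δ' : ℝ} (hr : 0 < r) (hδ' : 0 < δ') {P F : L2H N}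
    (hF : (F : UnitAddTorus (Fin N × Fin 3) → ℂ) =ᵐ[volume]
      fun t => (Torus.pairCutoff θ' r δ' t : ℂ) * (P : UnitAddTorus (Fin N × Fin 3) → ℂ) t)
    {B : ℝ≥0∞} (hB : ∀ i j : Fin N, i ≠ j →
      ∫⁻ t in {t | r + δ' / 2 < Torus.pairDist i j t ∧ Torus.pairDist i j t < r + 5 * δ' / 2},
        ‖(P : UnitAddTorus (Fin N × Fin 3) → ℂ) t‖ₑ ^ 2 / ENNReal.ofReal ((Torus.pairDist i j t - r) ^ 2) ≤ B)
    {ε : ℝ} (hε : 0 < ε) :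
    maxFormKin L F ≤ ENNReal.ofReal (1 + ε) * maxFormKin L P +
      ENNReal.ofReal ((2 * Real.pi / L) ^ 2) * ((Fintype.card (Fin N × Fin 3) : ℝ≥0∞) *
        (ENNReal.ofReal (1 + ε⁻¹) * ENNReal.ofReal (1 / (2 * Real.pi) ^ 2) *
          ((N : ℝ≥0∞) * (ENNReal.ofReal (25 * (K : ℝ) ^ 2) * ((N : ℝ≥0∞) * B))))) := by
  have hPmem := memLp_global P
  -- Fourier coefficients of `F` are those of `χ̃ P`
  have hcoef : ∀ n : Fin N × Fin 3 → ℤ, mFourierCoeff (F : UnitAddTorus (Fin N × Fin 3) → ℂ) n =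
      mFourierCoeff (fun t => (Torus.pairCutoff θ' r δ' t : ℂ) * (P : UnitAddTorus (Fin N × Fin 3) → ℂ) t) n := by
    intro n
    have hF' := hF
    rw [Torus.volume_eq_pi_haarAddCircle] at hF'
    exact integral_congr_ae (hF'.mono fun t ht => by
      show _ • _ = _ • _
      rw [ht])
  -- the collar sums, diagonal included
  have hcollar : ∀ i : Fin N, ∑ j : Fin N,
      ∫⁻ t in {t | r + δ' / 2 < Torus.pairDist i j t ∧ Torus.pairDist i j t < r + 5 * δ' / 2},
        ‖(P : UnitAddTorus (Fin N × Fin 3) → ℂ) t‖ₑ ^ 2 / ENNReal.ofReal ((Torus.pairDist i j t - r) ^ 2) ≤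
      (N : ℝ≥0∞) * B := by
    intro i
    calc _ ≤ ∑ j : Fin N, B := Finset.sum_le_sum fun j _ => ?_
      _ = (N : ℝ≥0∞) * B := by rw [Finset.sum_const, Finset.card_univ, Fintype.card_fin, nsmul_eq_mul]
    rcases eq_or_ne i j with h | h
    · subst h
      have hempty : {t : UnitAddTorus (Fin N × Fin 3) | r + δ' / 2 < Torus.pairDist i i t ∧
          Torus.pairDist i i t < r + 5 * δ' / 2} = ∅ := by
        ext t
        simp only [mem_setOf_eq, mem_empty_iff_false, iff_false, not_and]
        intro h1
        have h0 : Torus.pairDist i i t = 0 := by simp [Torus.pairDist]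
        linarith
      rw [hempty, Measure.restrict_empty, lintegral_zero_measure]
      exact zero_le
    · exact hB i j h
  -- direction by direction
  rw [maxFormKin_eq_tsum_dir, maxFormKin_eq_tsum_dir, ← mul_assoc, mul_comm (ENNReal.ofReal (1 + ε)), mul_assoc,
    ← mul_add]
  refine mul_le_mul_right ?_ _
  simp only [hcoef]
  calc ∑ q : Fin N × Fin 3, ∑' n : Fin N × Fin 3 → ℤ, ENNReal.ofReal ((n q : ℝ) ^ 2) *
        ‖mFourierCoeff (fun t => (Torus.pairCutoff θ' r δ' t : ℂ) * (P : UnitAddTorus (Fin N × Fin 3) → ℂ) t) n‖ₑ ^ 2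
      ≤ ∑ q : Fin N × Fin 3, (ENNReal.ofReal (1 + ε) * ∑' n : Fin N × Fin 3 → ℤ, ENNReal.ofReal ((n q : ℝ) ^ 2) *
          ‖mFourierCoeff (P : UnitAddTorus (Fin N × Fin 3) → ℂ) n‖ₑ ^ 2 +
          ENNReal.ofReal (1 + ε⁻¹) * ENNReal.ofReal (1 / (2 * Real.pi) ^ 2) *
            ((N : ℝ≥0∞) * (ENNReal.ofReal (25 * (K : ℝ) ^ 2) * ((N : ℝ≥0∞) * B)))) := by
        refine Finset.sum_le_sum fun q _ => ?_
        rcases q with ⟨i, k⟩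
        refine (Torus.tsum_sq_pairCutoff_mul_le hθ' hδ' i k hPmem hε).trans ?_
        gcongr
        exact hcollar i
    _ = _ := by
        rw [Finset.sum_add_distrib, ← Finset.mul_sum, Finset.sum_const, Finset.card_univ, nsmul_eq_mul]

end Literature.MathematicalPhysics.QuantumManyBody.BoseGas

end
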